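import Summits.BirchSwinnertonDyer.BirchSwinnertonDyer.Theorems.PencilClassCorankDoor
import Summits.BirchSwinnertonDyer.BirchSwinnertonDyer.Theorems.DerivedCoinvariantProfileSigned
import HarnessLib

/-!
# The pencil-class corank door at a SUPERSINGULAR prime: necessity from Kobayashi alone

Cell `bsd-rank2`, seat p2, GEN 73 (K73-A″). Joins `PencilClassCorankDoor` (K73-A: two points with non-zero
`p`-adic pair regulator force `rank E(ℚ) ≥ 2`; the squeeze at `2` from Kato at an ordinary prime) with
`DerivedCoinvariantProfileSigned` (K73-E: the signed rank-`≥ 2` inequality and squeeze at a supersingular prime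
`p ≥ 5`, `a_p = 0`, from Kobayashi's Thm. 4.1 + Thm. 1.2 only). Theorems only; every hypothesis explicit.

* `squeeze_at_two_signed`: `a_p = 0`, `p` odd good, granting `thm41_signedCharIdeal_divisibility` and
  `thm12_signedSelmerDual_finite_torsion`: two points with `Reg_p(P,Q) ≠ 0` (ANY height datum) and
  `ord_{X=0} L_p^ε(E,X) ≤ 2` force `rank = 2`, `corank Ш[p^∞] = 0`, signed control
  (`rank_{ℤ_p} X^ε_Γ = corank Sel`), all higher derived lengths of `X^ε` zero, `(MC_T^ε)`, `ord = 2`.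
* `three_le_order_signed_of_two_lt_selmerCorank`: `corank Sel ≥ 3 ⟹ ord L_p^ε ≥ 3`.
* `squeeze_at_two_at_every_good_prime_ge_five`: for two points with `Reg_p(P,Q) ≠ 0` and ANY good `p ≥ 5`, the
  dichotomy ordinary/supersingular with the matching squeeze (Kato resp. Kobayashi as the only print inputs).
* the index-zero class forms.

In a pencil `E_t` the supersingular members at `p` fill whole residue classes `t ≡ t₀ (mod p)` (`a_p(E_t)`
depends on `t mod p` only), so K73-A (ordinary) was silent on a positive proportion of classes; this file gives
the NECESSITY half there. The SUFFICIENCY half at a supersingular prime would need the signed Schneider theorem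
(`±` `p`-adic heights), which is not in the tree. Barrier B1 honesty: no motion on `S0`.

References: Kobayashi 2003 [Kobayashi2003]; Kato 2004 [Kato2004Asterisque]; Mazur–Tate–Teitelbaum 1986 §II.4
[MazurTateTeitelbaum1986Invent]; Gouvêa Thm. 5.6.1 [Gouvea1993PadicNumbers].
-/

set_option linter.dupNamespace false

noncomputable section

open Filter Topology
open scoped BigOperators
open scoped MatrixGroups ModularForm
open CongruenceSubgroup WeierstrassCurve
open Literature.NumberTheory.EllipticCurves Literature.NumberTheory.EllipticCurves.IwasawaAlgebra
  Literature.NumberTheory.EllipticCurves.ModularForms Literature.NumberTheory.EllipticCurves.Kobayashi2003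
open Summit.BirchSwinnertonDyer.BirchSwinnertonDyer.Theorems.DerivedCoinvariantProfile
  Summit.BirchSwinnertonDyer.BirchSwinnertonDyer.Theorems.DerivedCoinvariantProfileSigned
  Summit.BirchSwinnertonDyer.BirchSwinnertonDyer.Theorems.PencilClassSchneiderDoor
  Summit.BirchSwinnertonDyer.BirchSwinnertonDyer.Theorems.PencilClassCorankDoor

namespace Summit.BirchSwinnertonDyer.BirchSwinnertonDyer.Theorems.PencilClassCorankDoorSigned

variable {p : ℕ} [Fact p.Prime]

section OneCurve

variable (W : WeierstrassCurve ℚ) [W.IsElliptic] [W.IsGloballyMinimal]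
  {D : PAdicHeightData W p} {P Q : W.toAffine.Point}
  {N : ℕ} [NeZero N] {f : CuspForm (Gamma0 N) 2} {κ : ZpExtension ℚ p} {γ : Field.absoluteGaloisGroup ℚ}
  {ε : ℤˣ}

/-- **NECESSITY FROM KOBAYASHI ALONE (the signed squeeze at `2`).** Odd good supersingular `p` (`a_p = 0`),
granting Kobayashi's Thm. 4.1 and Thm. 1.2: two points with `Reg_p(P,Q) ≠ 0` and `ord_{X=0} L_p^ε(E,X) ≤ 2` force
`rank E(ℚ) = 2`, `corank Ш[p^∞] = 0`, signed control, all higher derived lengths of `X^ε(E/ℚ_∞)` zero,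
`(MC_T^ε)` and `ord = 2`. [cite: Kobayashi2003, Thm. 1.2, Thm. 4.1, Thm. 9.4] [cite: MazurTateTeitelbaum1986Invent, §II.4] -/
theorem squeeze_at_two_signed
    (h41 : thm41_signedCharIdeal_divisibility) (h12 : thm12_signedSelmerDual_finite_torsion)
    (hp : p ≠ 2) (hgood : W.HasGoodReductionAtPrime p) (hap : W.frobeniusTrace p = 0)
    (hf : IsNewformOf W f) (hκ : κ.IsCyclotomic) (hγ : κ.IsTopGenerator γ) (hγ' : IsCyclotomicVariable p γ)
    {L : IwasawaAlgebra p} (hL : IsSignedPAdicLFunction f p ε L) (Dsel : SignedSelmerDualData W κ γ ε)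
    (h : padicRegulatorOf D ![P, Q] ≠ 0) (hle : L.order ≤ 2) :
    W.mordellWeilRank = 2 ∧ W.shaCorank p = 0 ∧ coinvariantsRank p Dsel.X = W.selmerCorank p ∧
      (∀ i, 1 ≤ i → derivedLength p Dsel.X i = 0) ∧
      Module.lengthAt (IwasawaAlgebra p) Dsel.X (primeT p) = L.order ∧ L.order = 2 := by
  haveI : Module.Finite (IwasawaAlgebra p) Dsel.X := h12.moduleFinite hp hgood hap hκ hγ Dsel
  have h2 := two_le_mordellWeilRank_of_pair_ne_zero D P Q h
  have hle' : L.order ≤ W.mordellWeilRank := hle.trans (by exact_mod_cast h2)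
  obtain ⟨hsha, hctrl, -, he, hℓ, hord'⟩ :=
    defects_eq_zero_of_order_le_rank_signed p W h41 h12 hp hgood hap hf hκ hγ hγ' hL Dsel hle'
  have hr : (W.mordellWeilRank : ℕ∞) ≤ 2 := hord' ▸ hle
  have hr2 : W.mordellWeilRank = 2 := le_antisymm (by exact_mod_cast hr) h2
  exact ⟨hr2, hsha, hctrl, he, hℓ, by rw [hord', hr2]; rfl⟩

/-- Contrapositive: `Reg_p(P,Q) ≠ 0` and `corank Sel_{p^∞}(E/ℚ) ≥ 3` force `3 ≤ ord_{X=0} L_p^ε(E,X)`, from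
Kobayashi alone. [cite: Kobayashi2003, Thm. 4.1, Thm. 9.4] -/
theorem three_le_order_signed_of_two_lt_selmerCorank
    (h41 : thm41_signedCharIdeal_divisibility) (h12 : thm12_signedSelmerDual_finite_torsion)
    (hp : p ≠ 2) (hgood : W.HasGoodReductionAtPrime p) (hap : W.frobeniusTrace p = 0)
    (hf : IsNewformOf W f) (hκ : κ.IsCyclotomic) (hγ : κ.IsTopGenerator γ) (hγ' : IsCyclotomicVariable p γ)
    {L : IwasawaAlgebra p} (hL : IsSignedPAdicLFunction f p ε L) (Dsel : SignedSelmerDualData W κ γ ε)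
    (h : padicRegulatorOf D ![P, Q] ≠ 0) (hS : 2 < W.selmerCorank p) : 3 ≤ L.order := by
  by_contra hlt
  have hle : L.order ≤ 2 := by
    rw [not_le] at hlt
    exact Order.le_of_lt_succ hlt
  obtain ⟨hr2, hsha, -⟩ := squeeze_at_two_signed W h41 h12 hp hgood hap hf hκ hγ hγ' hL Dsel h hle
  have hid := W.selmerCorank_eq_mordellWeilRank_add_holds p
  omega

/-- **Necessity at EVERY good prime `p ≥ 5` (two points with `Reg_p(P,Q) ≠ 0`).** Either `p` is ordinary and,
granting `kato_divisibility`, `ord_{T=0} L_p(E,T) ≤ 2 ⟹ rank = 2 ∧ corank Ш[p^∞] = 0 ∧ ord = 2`; or `a_p = 0` and,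
granting Kobayashi's two theorems, the same for every signed `L_p^ε`. [cite: Kato2004Asterisque, Thm. 17.4]
[cite: Kobayashi2003, Thm. 1.2, Thm. 4.1] [cite: Serre1981, §8.2] -/
theorem squeeze_at_two_at_every_good_prime_ge_five (hp5 : 5 ≤ p) (hgood : W.HasGoodReductionAtPrime p)
    (hf : IsNewformOf W f) (hκ : κ.IsCyclotomic) (hγ : κ.IsTopGenerator γ) (hγ' : IsCyclotomicVariable p γ)
    (h : padicRegulatorOf D ![P, Q] ≠ 0) :
    (IsOrdinaryAt W p ∧
        (kato_divisibility W p (κ := κ) (γ := γ) (f := f) → ∀ Dsel : W.SelmerDualData κ γ,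
          (padicLFunction f (unitRoot W p : ℚ_[p])).order ≤ 2 →
            W.mordellWeilRank = 2 ∧ W.shaCorank p = 0 ∧
              (padicLFunction f (unitRoot W p : ℚ_[p])).order = 2)) ∨
      (W.frobeniusTrace p = 0 ∧
        (thm41_signedCharIdeal_divisibility → thm12_signedSelmerDual_finite_torsion →
          ∀ (ε : ℤˣ) (L : IwasawaAlgebra p), IsSignedPAdicLFunction f p ε L →
            ∀ Dsel : SignedSelmerDualData W κ γ ε, L.order ≤ 2 →
              W.mordellWeilRank = 2 ∧ W.shaCorank p = 0 ∧ L.order = 2)) := by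
  have hp2 : p ≠ 2 := by omega
  rcases isOrdinaryAt_or_frobeniusTrace_eq_zero p W hp5 hgood with hord | hap
  · refine Or.inl ⟨hord, fun hK Dsel hle ↦ ?_⟩
    obtain ⟨hr, hsha, -, -, ho⟩ := squeeze_at_two_of_kato W hK hp2 hord hκ hγ hγ' hf Dsel h hle
    exact ⟨hr, hsha, ho⟩
  · refine Or.inr ⟨hap, fun h41 h12 ε L hL Dsel hle ↦ ?_⟩
    obtain ⟨hr, hsha, -, -, -, ho⟩ := squeeze_at_two_signed W h41 h12 hp2 hgood hap hf hκ hγ hγ' hL Dsel h hle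
    exact ⟨hr, hsha, ho⟩

end OneCurve

section Class

variable {T : Type*} {E : T → WeierstrassCurve ℚ} [∀ τ, (E τ).IsElliptic] [∀ τ, (E τ).IsGloballyMinimal]
  {P Q : ∀ τ, (E τ).toAffine.Point} {Dh : ∀ τ, PAdicHeightData (E τ) p}
  (param : T → ℤ_[p]) (coeff : ℕ → ℚ_[p])

/-- **Necessity on an index-zero class at a supersingular member**, from Kobayashi alone.
[cite: Kobayashi2003, Thm. 1.2, Thm. 4.1] [cite: Gouvea1993PadicNumbers, §5.6 Thm. 5.6.1] -/
theorem squeeze_at_two_of_index_zero_signed (hcoeff : Tendsto coeff atTop (𝓝 0))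
    (hreg : ∀ τ, padicRegulatorOf (Dh τ) ![P τ, Q τ] = ∑' n, coeff n * (param τ : ℚ_[p]) ^ n)
    (hcert : ∀ n, 0 < n → ‖coeff n‖ < ‖coeff 0‖) (τ : T) {N : ℕ} [NeZero N]
    {f : CuspForm (Gamma0 N) 2} {κ : ZpExtension ℚ p} {γ : Field.absoluteGaloisGroup ℚ} {ε : ℤˣ}
    (h41 : thm41_signedCharIdeal_divisibility) (h12 : thm12_signedSelmerDual_finite_torsion)
    (hp : p ≠ 2) (hgood : (E τ).HasGoodReductionAtPrime p) (hap : (E τ).frobeniusTrace p = 0)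
    (hf : IsNewformOf (E τ) f) (hκ : κ.IsCyclotomic) (hγ : κ.IsTopGenerator γ)
    (hγ' : IsCyclotomicVariable p γ) {L : IwasawaAlgebra p} (hL : IsSignedPAdicLFunction f p ε L)
    (Dsel : SignedSelmerDualData (E τ) κ γ ε) (hle : L.order ≤ 2) :
    (E τ).mordellWeilRank = 2 ∧ (E τ).shaCorank p = 0 ∧ coinvariantsRank p Dsel.X = (E τ).selmerCorank p ∧
      (∀ i, 1 ≤ i → derivedLength p Dsel.X i = 0) ∧
      Module.lengthAt (IwasawaAlgebra p) Dsel.X (primeT p) = L.order ∧ L.order = 2 :=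
  squeeze_at_two_signed (E τ) h41 h12 hp hgood hap hf hκ hγ hγ' hL Dsel
    (regulator_ne_zero_of_index_zero param coeff hcoeff hreg hcert τ) hle

/-- **Necessity on an index-zero class at every good prime `p ≥ 5`** (ordinary: Kato; supersingular: Kobayashi).
[cite: Kato2004Asterisque, Thm. 17.4] [cite: Kobayashi2003, Thm. 1.2, Thm. 4.1] [cite: Gouvea1993PadicNumbers, §5.6 Thm. 5.6.1] -/
theorem squeeze_at_two_of_index_zero_at_every_good_prime_ge_five (hcoeff : Tendsto coeff atTop (𝓝 0))
    (hreg : ∀ τ, padicRegulatorOf (Dh τ) ![P τ, Q τ] = ∑' n, coeff n * (param τ : ℚ_[p]) ^ n)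
    (hcert : ∀ n, 0 < n → ‖coeff n‖ < ‖coeff 0‖) (hp5 : 5 ≤ p) (τ : T)
    (hgood : (E τ).HasGoodReductionAtPrime p) {N : ℕ} [NeZero N] {f : CuspForm (Gamma0 N) 2}
    (hf : IsNewformOf (E τ) f) {κ : ZpExtension ℚ p} {γ : Field.absoluteGaloisGroup ℚ}
    (hκ : κ.IsCyclotomic) (hγ : κ.IsTopGenerator γ) (hγ' : IsCyclotomicVariable p γ) :
    (IsOrdinaryAt (E τ) p ∧
        (kato_divisibility (E τ) p (κ := κ) (γ := γ) (f := f) → ∀ Dsel : (E τ).SelmerDualData κ γ,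
          (padicLFunction f (unitRoot (E τ) p : ℚ_[p])).order ≤ 2 →
            (E τ).mordellWeilRank = 2 ∧ (E τ).shaCorank p = 0 ∧
              (padicLFunction f (unitRoot (E τ) p : ℚ_[p])).order = 2)) ∨
      ((E τ).frobeniusTrace p = 0 ∧
        (thm41_signedCharIdeal_divisibility → thm12_signedSelmerDual_finite_torsion →
          ∀ (ε : ℤˣ) (L : IwasawaAlgebra p), IsSignedPAdicLFunction f p ε L →
            ∀ Dsel : SignedSelmerDualData (E τ) κ γ ε, L.order ≤ 2 →
              (E τ).mordellWeilRank = 2 ∧ (E τ).shaCorank p = 0 ∧ L.order = 2)) :=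
  squeeze_at_two_at_every_good_prime_ge_five (E τ) hp5 hgood hf hκ hγ hγ'
    (regulator_ne_zero_of_index_zero param coeff hcoeff hreg hcert τ)

end Class

end Summit.BirchSwinnertonDyer.BirchSwinnertonDyer.Theorems.PencilClassCorankDoorSigned

end
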